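import Summits.QuantumFields.YangMills.Theorems.BalabanUVNodesN07ShearSizeTopBoxDataAxial
import Summits.QuantumFields.YangMills.Theorems.BalabanUVNodesN07AxialTowerRepresentative
import HarnessLib

/-!
# DAG node N07 [B11] — road R0′ rows (r1)+(r4) AT THE RECORD with module 40's data identity `hdata` DISCHARGED BY THE CHOICE OF THE REPRESENTATIVE: composing the axial-tower gauge
# `u₀` of Sect. F's first step with the block-constant lift `h̄ = blockLift j h` of the data's coarse axial gauge `h = axialGauge V lo hi` on the top box, `V := M^j(U₁^{u₀})`
# ([B11] (147) «V … is changed into a configuration V′ … V′₁ satisfies the generalized axial gauge conditions on □_k^{(k)}»), KEEPS the block axial gauges below `j`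
# (this base's `axialTower_gaugeAct_blockLift`) and MAKES the level-`j` data of the representative `U₁^{h̄u₀}` equal to `V^h` on EVERY bond (dag-n09-w3's `iter_gaugeAct_blockLift`)

Cell `pub-ymgap` (HUMAN RULINGS D-0062 ∕ D-0088 ∕ D-0149), width seat `pub-ymgap-dag-n07-w6` (second wave), harness re-seat g0″, 2026-08-28; CLAIM-2 of this generation (own lineage: the
(r4)-rec rows p613291 ∕ p613938 ∕ p615982 display `hdata`, the axial tower is this base's p610328).  `--kind proof --supports stmt-QuantumFields-27364 --as helper` (K1⁹ per dag-lead KEY MAP v2;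
count-neutral).  THEOREMS ONLY.

THE PRINT.  [B11] = [15] = T. Bałaban, Commun. Math. Phys. **102** (1985) 277–309 `[Balaban1985Variational]`: p. 300 (Sect. F, first step) «Applying a gauge transformation to U_k we get a
configuration U′_k such, that U′_k ∈ Ax_k(□̃(k), 1)», p. 301 (147) «the configuration V defining this space is changed into a configuration V′ … V′₁ satisfies the generalized axial gauge
conditions on □_k^{(k)} with a center at the point y», p. 307 (181) «v̄ is constant on blocks B^j(y), y ∈ Λ_j, and equal to v(y)»; [6] = [Balaban1985RegularSpaces] (1.15) p. 78.

WHAT THIS FILE DOES (kernel gauge algebra BY NAME; NOTHING of [B11]∕[15]∕[6]∕[3] analysis asserted).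
* §1 (generic `P`, `G`, `av`, `cd`): ★ `axialTower_iter_gaugeAct_blockLift_mul` — for `j ≤ m + K`, ANY coarse transformation `h` of `T^{(j)}`, any `u₀`, `U₁`: if `M^i(U₁^{u₀})`, `i < j`, are
  block-axial then so are `M^i(U₁^{u})` for `u := h̄·u₀` (`h̄ = blockLift j h`), AND `M^j(U₁^{u}) = (M^j(U₁^{u₀}))^h` — `gaugeAct_gaugeAct` + this base's `axialTower_gaugeAct_blockLift` +
  dag-n09-w3's `iter_gaugeAct_blockLift`.
* §2 AT THE RECORD with pv26's axial gauge of the DATA on a box `[lo, hi]` of `T^{(j)}` (`h := axialGauge V lo hi`, `V := M^j(U₁^{u₀})`): ★★ `iter_avOfRecord_towerGauge_eq_dataAxial` — the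
  `hdata` identity of p615982 ∕ `…ChartA` holds for `u := h̄·u₀` on EVERY bond of `T^{(j)}` (not only on the box); ★★ `axialTower_towerGauge` — the tower below `j` is kept;
  `exists_gauge_axialTower_dataAxial` (∃-form); ★ `isBackground_towerGauge` — if `U₁^{u₀}` minimises the Wilson action of record over its own data `V` in `bgReg`, then `U₁^{u}` minimises it over
  the re-gauged data `V^h` (dag-n07-e module 40 `isBackground_dataAxial`, [B11] (147) ∕ (181) at the record); ★★ `iter_avOfRecord_eq_dataAxial_of_rep` + `axialTower_rep_blockLift` — the
  REPRESENTATIVE FORM (the knit's shape): for ANY `U′` (the tower representative) and ANY pair `(u, U₁)` with `U₁^{u} = U′^{h̄}`, `h := axialGauge (M^j U′) lo hi` ([6] Thm 2's Landau copy in the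
  knit), the data of `U₁^{u}` is `(M^j U′)^h`, and `U′^{h̄}` keeps the tower; ★★ `shearedAvgIter_avOfRecord_eq_dataAxial_of_rep` — (154)₁ AT THE RECORD in that shape: under the (81)∕(1.29)
  normalisation of `u` at the bond's ends, `𝒜_j(U₁)(c) = (V^h)(c)` (p608036 `shearedAvgIter_avOfRecord_eq_data`, `hax` and the constraint supplied).
* §3 ★★★ `norm_mlog_iter_avOfRecord_centred_sub_le_towerGauge` — this base's composed rows (r1)+(r4) `…DataAxial.norm_mlog_iter_avOfRecord_centred_sub_le_dataAxial` AT `u := h̄·u₀` with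
  `hdata` DISCHARGED by §2: the data letter is `v := (d−1)nδ` from the plaquette smallness `PlaqSmallOn S₀ δ (M^j(U₁^{u₀}))` of the representative's OWN level-`j` data on the box plaquettes
  ([B11] (7) for the data — a gauge-invariant, i.e. class, condition); displayed: that smallness, the Landau copy's letter `a` (supplied by this base's `…ChartA` from the chart), the box's extent
  `hi ≤ lo + n`, non-wrapping `n + 1 < N_j`, the thresholds.  ★ `norm_mlog_iter_avOfRecord_centred_sub_le_towerGauge_of_isBackground` — the same keyed on a minimiser `U₁^{u₀}` of record over data
  `V` (`IsBackground … j V (U₁^{u₀})`, so `M^j(U₁^{u₀}) = V` literally): smallness asked of `V` itself.  ★★★ `norm_mlog_iter_avOfRecord_centred_sub_le_of_rep` — the KNIT-SHAPED edition: rows for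
  ANY pair `(u, U₁)` with `U₁^{u} = U′^{h̄}` (`hrep`), `hdata` discharged by `hrep`, smallness asked of `M^j(U′)`.
* §4 (A6) NON-VACUITY: `towerGauge_data_one` ∕ `plaqSmallOn_towerGauge_data_one` — at `U₁ = 1`, `u₀ = 1` the representative's data is `1` and §3's plaquette hypothesis holds for every
  `δ > 0` (pv26 `plaqSmallOn_one` by name); with `a = 0` (p613938 `dist1_iter_avOfRecord_one`) the binder block of §3 is inhabited on every box of every torus.

HONEST FRAMING (binding).  Count-neutral helper; by-name composition of LANDED theorems (this base p610328 ∕ p615982, dag-n07-e module 40 p606565, dag-n09-w2∕w3 `…N09AxialSelectionExists` ∕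
`…N09LiftInvariance29AtRecord`, r13 `B16Sect1Backgrounds`, r15 `B15Eq177GaugeInvariance`, pv26 `T4AxialGaugeSmallField`).  LOCATED (said, not hidden): the composite gauge `u := h̄·u₀` of §2∕§3
re-gauges a GIVEN `U₁` and does NOT carry the (81)∕(1.29) normalisation of `u₀` (`R̄ʲ(h̄·u₀) = h·R̄ʲu₀`); in print the top-box axial gauge (147) is applied to `U_k` BEFORE [6] Thm 2, so the honest
binder for the knit is the REPRESENTATIVE FORM `hrep : U₁^{u} = U′^{h̄}` on Thm 2's own pair `(u, U₁)` (the `_of_rep` theorems), for which (1.29) stays Thm 2's displayed output.  The (r4)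
data letters `v_j` for `j < k` ((155) at the representative) are NOT supplied here.  The Landau copy `U₁` of [6] Thm 2 and its gauge `u₀` are NOT
constructed (binders); the letter `a`, the class smallness, the thresholds and the box geometry are HYPOTHESES; nothing of [B11]∕[15]∕[6]∕[3] analysis asserted; BRIDGE-92-B stays GAP-STATED
until the S6 head knits (r0)–(r4); `stub_prop8StepCoP13` ∕ K0⁷ ∕ K1⁹ NOT closed; N07 NOT discharged; the chair's tally of record is the only count; **no summit statement is proved by this
seat** — one finite `T⁴` programme at fixed `ε`, Bałaban AS PRINTED; the route closes the conditional finite-𝕋⁴ rung `BalabanLadder.UV` only; NOT continuum ∕ ℝ⁴ ∕ OS ∕ mass gap ∕ Clay.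
No `sorry`, no `def`, no `instance`, no `notation`.
-/

noncomputable section

namespace Summit.QuantumFields.YangMills.BalabanUVNodes.N07ShearSizeTopBoxTowerGauge

open scoped Matrix.Norms.L2Operator
open Literature.MathematicalPhysics.QuantumFieldTheory.Balaban1983to89
open Literature.MathematicalPhysics.QuantumFieldTheory.Balaban1983to89.Node00
open T4Continuum
open T4AxialGaugeSmallField (castSite axialGauge boxPlaqs)
open B16Sect1Backgrounds (toMS gaugeAct_gaugeAct)
open B15Eq177GaugeInvariance (blockLift)
open GaugeField (gaugeAct)
open MatrixLog (mlog)
open ExpMeanLog (expMeanLogSU)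
open Summit.QuantumFields.YangMills.BalabanUVNodes.N09AxialSelectionExists (iter_gaugeAct_blockLift)
open Summit.QuantumFields.YangMills.BalabanUVNodes.N07AxialTowerRepresentative (axialTower_gaugeAct_blockLift exists_axialTower)
open Summit.QuantumFields.YangMills.BalabanUVNodes.N07DataAxialTopBox (isBackground_dataAxial)
open Summit.QuantumFields.YangMills.BalabanUVNodes.N07ShearSizeTopBoxDataAxial (norm_mlog_iter_avOfRecord_centred_sub_le_dataAxial)

/-! ## §1  Generic: the coarse gauge lifted on top of an axial tower keeps the tower and re-gauges the top data -/

section Generic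

variable {P : Params} {G : Type*} [GaugeGroup G] (av : ∀ i, Averaging P i G) (cd : ∀ i, ContourData P i G)

/-- ★ **A COARSE GAUGE ON TOP OF AN AXIAL TOWER**: for `j ≤ m + K`, a coarse transformation `h` of `T^{(j)}`, any `u₀ : T_η → G` and `U₁`, put `u := h̄·u₀` with `h̄ = blockLift j h`
([15] (181)).  If the averages `M^i(U₁^{u₀})`, `i < j`, are block-axial for `cd i`, then so are the `M^i(U₁^{u})`, and at the top `M^j(U₁^{u}) = (M^j(U₁^{u₀}))^h` — `U₁^{u} = (U₁^{u₀})^{h̄}`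
(`gaugeAct_gaugeAct`), the tower by `axialTower_gaugeAct_blockLift`, the top by `iter_gaugeAct_blockLift`. [cite: Balaban1985Variational, (147) p.301, (181) p.307; Balaban1985RegularSpaces, (1.15) p.78] -/
theorem axialTower_iter_gaugeAct_blockLift_mul {j : ℕ} (hj : j ≤ P.m + P.K) (h : GaugeTransf P j G) (u₀ : GaugeTransf P 0 G) (U₁ : GaugeField P 0 G)
    (hax : ∀ i < j, AxialGauge (cd i) (Averaging.iter av i (gaugeAct u₀ U₁))) :
    (∀ i < j, AxialGauge (cd i) (Averaging.iter av i (gaugeAct (fun x => blockLift j h x * u₀ x) U₁))) ∧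
      Averaging.iter av j (gaugeAct (fun x => blockLift j h x * u₀ x) U₁) = gaugeAct h (Averaging.iter av j (gaugeAct u₀ U₁)) := by
  have hcomp : gaugeAct (fun x => blockLift j h x * u₀ x) U₁ = gaugeAct (blockLift j h) (gaugeAct u₀ U₁) := (gaugeAct_gaugeAct _ _ _).symm
  rw [hcomp]
  exact ⟨axialTower_gaugeAct_blockLift av cd j hj h (gaugeAct u₀ U₁) hax, iter_gaugeAct_blockLift av hj h (gaugeAct u₀ U₁)⟩

/-- The top identity alone (no tower hypothesis): `M^j(U₁^{h̄·u₀}) = (M^j(U₁^{u₀}))^h` for every coarse `h`. [cite: Balaban1985Variational, (181) p.307] -/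
theorem iter_gaugeAct_blockLift_mul {j : ℕ} (hj : j ≤ P.m + P.K) (h : GaugeTransf P j G) (u₀ : GaugeTransf P 0 G) (U₁ : GaugeField P 0 G) :
    Averaging.iter av j (gaugeAct (fun x => blockLift j h x * u₀ x) U₁) = gaugeAct h (Averaging.iter av j (gaugeAct u₀ U₁)) := by
  have hcomp : gaugeAct (fun x => blockLift j h x * u₀ x) U₁ = gaugeAct (blockLift j h) (gaugeAct u₀ U₁) := (gaugeAct_gaugeAct _ _ _).symm
  rw [hcomp, iter_gaugeAct_blockLift av hj h (gaugeAct u₀ U₁)]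

end Generic

/-! ## §2  At the record: the tower gauge composed with the data's coarse axial gauge on the top box -/

section Record

variable (F : T4Continuum.T4Family) (N : ℕ) [NeZero N]

/-- ★★ **`hdata` DISCHARGED BY THE CHOICE OF THE REPRESENTATIVE** (averaging of record, torus `K`, `j ≤ m + K`, a box `[lo, hi]` of `T^{(j)}`, any `u₀`, `U₁`): with `V := M^j(U₁^{u₀})`,
`h := axialGauge V lo hi` (pv26) and `u := h̄·u₀`, the level-`j` data of `U₁^{u}` IS the axially re-gauged datum `V^h` — on EVERY bond of `T^{(j)}`, in particular on the box bonds
(the `hdata` binder of this base's `…DataAxial` ∕ `…ChartA` rows, letter for letter). [cite: Balaban1985Variational, (147) p.301, (181) p.307] -/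
theorem iter_avOfRecord_towerGauge_eq_dataAxial (K : ℕ) {j : ℕ} (hj : j ≤ (F.P K).m + (F.P K).K) (u₀ : GaugeTransf (F.P K) 0 (SU N)) (U₁ : GaugeField (F.P K) 0 (SU N))
    (lo hi : Fin (F.P K).d → ℤ) :
    ∀ c : PBond (F.P K) j, c.src ∈ (castSite '' Set.Icc lo hi : Set (Site (F.P K) j)) → c.tgt ∈ (castSite '' Set.Icc lo hi : Set (Site (F.P K) j)) →
      Averaging.iter (avOfRecord F N K) j
          (gaugeAct (fun x => blockLift j (axialGauge (Averaging.iter (avOfRecord F N K) j (gaugeAct u₀ U₁)) lo hi) x * u₀ x) U₁) c =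
        gaugeAct (axialGauge (Averaging.iter (avOfRecord F N K) j (gaugeAct u₀ U₁)) lo hi) (Averaging.iter (avOfRecord F N K) j (gaugeAct u₀ U₁)) c :=
  fun c _ _ => congrFun (iter_gaugeAct_blockLift_mul (avOfRecord F N K) hj _ u₀ U₁) c

/-- ★★ **THE TOWER IS KEPT**: if `M^i(U₁^{u₀})`, `i < j`, are block-axial for the contour datum of record, so are the `M^i(U₁^{u})` for `u := h̄·u₀`, `h` the data's coarse axial gauge on the
box (or ANY coarse transformation). [cite: Balaban1985Variational, p.300 (Sect. F), (147) p.301; Balaban1985RegularSpaces, (1.15) p.78] -/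
theorem axialTower_towerGauge (K : ℕ) {j : ℕ} (hj : j ≤ (F.P K).m + (F.P K).K) (h : GaugeTransf (F.P K) j (SU N)) (u₀ : GaugeTransf (F.P K) 0 (SU N))
    (U₁ : GaugeField (F.P K) 0 (SU N)) (hax : ∀ i < j, AxialGauge (contourOfRecord F N K i) (Averaging.iter (avOfRecord F N K) i (gaugeAct u₀ U₁))) :
    ∀ i < j, AxialGauge (contourOfRecord F N K i) (Averaging.iter (avOfRecord F N K) i (gaugeAct (fun x => blockLift j h x * u₀ x) U₁)) :=
  (axialTower_iter_gaugeAct_blockLift_mul (avOfRecord F N K) (contourOfRecord F N K) hj h u₀ U₁ hax).1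

/-- **∃-form** ([B11] p.300–301, Sect. F's first step WITH (147)): for every `U₁`, `j ≤ m + K` and box `[lo, hi]` there is a gauge `u` such that `U′ := U₁^{u}` carries the block axial gauges of
record at every level `< j` AND its level-`j` data equals `V^h`, `h = axialGauge V lo hi`, for the data `V` of an axial-tower representative — `u := h̄·w` for this base's `exists_axialTower`.
[cite: Balaban1985Variational, p.300–301 (Sect. F, (147)); Balaban1985RegularSpaces, (1.15) p.78] -/
theorem exists_gauge_axialTower_dataAxial (K : ℕ) {j : ℕ} (hj : j ≤ (F.P K).m + (F.P K).K) (U₁ : GaugeField (F.P K) 0 (SU N)) (lo hi : Fin (F.P K).d → ℤ) :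
    ∃ (w u : GaugeTransf (F.P K) 0 (SU N)),
      (∀ i < j, AxialGauge (contourOfRecord F N K i) (Averaging.iter (avOfRecord F N K) i (gaugeAct w U₁))) ∧
      (∀ i < j, AxialGauge (contourOfRecord F N K i) (Averaging.iter (avOfRecord F N K) i (gaugeAct u U₁))) ∧
      Averaging.iter (avOfRecord F N K) j (gaugeAct u U₁) =
        gaugeAct (axialGauge (Averaging.iter (avOfRecord F N K) j (gaugeAct w U₁)) lo hi) (Averaging.iter (avOfRecord F N K) j (gaugeAct w U₁)) := by
  obtain ⟨w, hw⟩ := exists_axialTower (avOfRecord F N K) (contourOfRecord F N K) hj U₁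
  have h := axialTower_iter_gaugeAct_blockLift_mul (avOfRecord F N K) (contourOfRecord F N K) hj
    (axialGauge (Averaging.iter (avOfRecord F N K) j (gaugeAct w U₁)) lo hi) w U₁ hw
  exact ⟨w, _, hw, h.1, h.2⟩

/-- ★ **THE MINIMISER GOES ALONG** ([B11] (147) ∕ (181) at the record, dag-n07-e module 40 `isBackground_dataAxial`): if `U₁^{u₀}` minimises the Wilson action of record over data `V` in the class
`bgReg` of record (level `k ≤ m + K`), then `U₁^{u}`, `u := h̄·u₀` with `h := axialGauge V lo hi`, minimises it over the re-gauged data `V^h`. [cite: Balaban1985Variational, (147) p.301, (181) p.307] -/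
theorem isBackground_towerGauge (K : ℕ) {k : ℕ} (hk : k ≤ (F.P K).m + (F.P K).K) {ε : ℝ} {V : GaugeField (F.P K) k (SU N)} (u₀ : GaugeTransf (F.P K) 0 (SU N))
    (U₁ : GaugeField (F.P K) 0 (SU N)) (h : IsBackground (avOfRecord F N K) (bgReg F N K k ε) k V (gaugeAct u₀ U₁)) (lo hi : Fin (F.P K).d → ℤ) :
    IsBackground (avOfRecord F N K) (bgReg F N K k ε) k (gaugeAct (axialGauge V lo hi) V)
      (gaugeAct (fun x => blockLift k (axialGauge V lo hi) x * u₀ x) U₁) := by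
  have hcomp : gaugeAct (fun x => blockLift k (axialGauge V lo hi) x * u₀ x) U₁ = gaugeAct (blockLift k (axialGauge V lo hi)) (gaugeAct u₀ U₁) :=
    (gaugeAct_gaugeAct _ _ _).symm
  rw [hcomp]
  exact isBackground_dataAxial hk h lo hi

/-- ★★ **REPRESENTATIVE FORM (the knit's shape)**: let `U′` be ANY configuration (in the knit: the axial-tower representative of the minimiser of record, p610328
`exists_axialTower_isBackground`), `V := M^j(U′)`, `h := axialGauge V lo hi`, and let the pair `(u, U₁)` (in the knit: [6] Thm 2's normalised Landau gauge and the Landau copy) satisfy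
`U₁^{u} = U′^{h̄}` (`hrep`).  Then the level-`j` data of `U₁^{u}` is `V^h` on every bond — the `hdata` binder of this base's rows for THAT pair, discharged by `iter_gaugeAct_blockLift`.
[cite: Balaban1985Variational, (147) p.301, (152) p.301, (181) p.307] -/
theorem iter_avOfRecord_eq_dataAxial_of_rep (K : ℕ) {j : ℕ} (hj : j ≤ (F.P K).m + (F.P K).K) (U' : GaugeField (F.P K) 0 (SU N)) (u : GaugeTransf (F.P K) 0 (SU N))
    (U₁ : GaugeField (F.P K) 0 (SU N)) (lo hi : Fin (F.P K).d → ℤ)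
    (hrep : gaugeAct u U₁ = gaugeAct (blockLift j (axialGauge (Averaging.iter (avOfRecord F N K) j U') lo hi)) U') :
    ∀ c : PBond (F.P K) j, c.src ∈ (castSite '' Set.Icc lo hi : Set (Site (F.P K) j)) → c.tgt ∈ (castSite '' Set.Icc lo hi : Set (Site (F.P K) j)) →
      Averaging.iter (avOfRecord F N K) j (gaugeAct u U₁) c =
        gaugeAct (axialGauge (Averaging.iter (avOfRecord F N K) j U') lo hi) (Averaging.iter (avOfRecord F N K) j U') c := by
  intro c _ _
  rw [hrep, iter_gaugeAct_blockLift (avOfRecord F N K) hj _ U']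

/-- The representative `U′^{h̄}` keeps `U′`'s axial tower below `j` (this base's `axialTower_gaugeAct_blockLift` at the record). [cite: Balaban1985Variational, p.300 (Sect. F); Balaban1985RegularSpaces, (1.15) p.78] -/
theorem axialTower_rep_blockLift (K : ℕ) {j : ℕ} (hj : j ≤ (F.P K).m + (F.P K).K) (h : GaugeTransf (F.P K) j (SU N)) (U' : GaugeField (F.P K) 0 (SU N))
    (hax : ∀ i < j, AxialGauge (contourOfRecord F N K i) (Averaging.iter (avOfRecord F N K) i U')) :
    ∀ i < j, AxialGauge (contourOfRecord F N K i) (Averaging.iter (avOfRecord F N K) i (gaugeAct (blockLift j h) U')) :=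
  axialTower_gaugeAct_blockLift (avOfRecord F N K) (contourOfRecord F N K) j hj h U' hax

/-- ★★ **(154)₁ AT THE RECORD IN THE KNIT'S SHAPE — data = the RE-GAUGED DATUM `V^h`**: for the tower representative `U′` (block axial gauges of record below `j`), `V := M^j(U′)`,
`h := axialGauge V lo hi`, and a pair `(u, U₁)` with `U₁^{u} = U′^{h̄}` and the (81)∕(1.29) normalisation of `u` at the bond's ends, the SHEARED `j`-fold average of record of `U₁` IS the
re-gauged datum: `𝒜_j(U₁)(c) = (V^h)(c)` — this base's p608036 `shearedAvgIter_avOfRecord_eq_data` with its `hax` supplied by `axialTower_rep_blockLift` and its constraint by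
`iter_gaugeAct_blockLift`. [cite: Balaban1985Variational, (147) p.301, (150) p.301, (154) p.302; Balaban1985Averaging, (88) p.31] -/
theorem shearedAvgIter_avOfRecord_eq_dataAxial_of_rep (K : ℕ) {j : ℕ} (hj : j ≤ (F.P K).m + (F.P K).K) (U' : GaugeField (F.P K) 0 (SU N))
    (hax : ∀ i < j, AxialGauge (contourOfRecord F N K i) (Averaging.iter (avOfRecord F N K) i U'))
    (u : GaugeTransf (F.P K) 0 (SU N)) (U₁ : GaugeField (F.P K) 0 (SU N)) (lo hi : Fin (F.P K).d → ℤ)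
    (hrep : gaugeAct u U₁ = gaugeAct (blockLift j (axialGauge (Averaging.iter (avOfRecord F N K) j U') lo hi)) U')
    {c : PBond (F.P K) j} (hsrc : gaugeAvgIter (loopAvgBlockOp expMeanLogSU) u j c.src = 1) (htgt : gaugeAvgIter (loopAvgBlockOp expMeanLogSU) u j c.tgt = 1) :
    shearedAvgIter (avOfRecord F N K) (contourOfRecord F N K) (loopAvgBlockOp expMeanLogSU) U₁ j c =
      gaugeAct (axialGauge (Averaging.iter (avOfRecord F N K) j U') lo hi) (Averaging.iter (avOfRecord F N K) j U') c := by
  have hax' : ∀ i < j, AxialGauge (contourOfRecord F N K i) (Averaging.iter (avOfRecord F N K) i (gaugeAct u U₁)) := by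
    rw [hrep]; exact axialTower_rep_blockLift F N K hj _ U' hax
  have hV : Averaging.iter (avOfRecord F N K) j (gaugeAct u U₁) c =
      gaugeAct (axialGauge (Averaging.iter (avOfRecord F N K) j U') lo hi) (Averaging.iter (avOfRecord F N K) j U') c := by
    rw [hrep, iter_gaugeAct_blockLift (avOfRecord F N K) hj _ U']
  exact shearedAvgIter_avOfRecord_eq_data F N K hj hax' hV hsrc htgt

end Record

/-! ## §3  Rows (r1)+(r4) at the record at the tower gauge: `hdata` discharged, `v := (d−1)nδ` from the representative's own data -/

section Rows

variable (F : T4Continuum.T4Family) (N : ℕ) [NeZero N]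

/-- ★★★ **ROWS (r1)+(r4) AT THE RECORD AT THE TOWER GAUGE `u := h̄·u₀` — `hdata` DISCHARGED.**  Averaging of record, torus `K`, level `j ≤ m + K`, a box `[lo, hi]` of `T^{(j)}` with
`hi ≤ lo + n` and non-wrapping `n + 1 < N_j`; the Landau copy `U₁` and ANY gauge `u₀` (in the knit: the axial-tower gauge of Sect. F's first step); let `V := M^j(U₁^{u₀})` have `δ`-small
plaquettes based in the box (`PlaqSmallOn S₀ δ V`, `boxPlaqs lo hi ⊆ S₀` — [B11] (7) for the data), and let the Landau copy's averages be `a`-small on the box bonds.  Then with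
`h := axialGauge V lo hi`, `u := h̄·u₀`, `σ♮ := D♮·((d−1)nδ + a) ≤ 1∕80`, `(d−1)nδ ≤ 1∕40`, on every box bond `c` (letters `g := u↾T^{(j)}`, `g₀ := g(castSite lo)`, `ĝ := g₀⁻¹g`,
`V♮(c) := g₀⁻¹·M^j(U₁^{u})(c)·g₀`): `‖log M^j(U₁)(c) − (log V♮(c) + (log ĝ(c₋)⁻¹ − log ĝ(c₊)⁻¹))‖ ≤ 8σ♮² + 20σ♮·(d−1)nδ` — p615982's row with its `hdata` supplied by §2.
[cite: Balaban1985Variational, (147) p.301, (151)–(156) pp.301–302, (160) p.303] -/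
theorem norm_mlog_iter_avOfRecord_centred_sub_le_towerGauge (K : ℕ) (u₀ : GaugeTransf (F.P K) 0 (SU N)) (U₁ : GaugeField (F.P K) 0 (SU N)) {j : ℕ}
    (hj : j ≤ (F.P K).m + (F.P K).K) {lo hi : Fin (F.P K).d → ℤ} {n : ℕ} (hn : ∀ κ, hi κ ≤ lo κ + n) (hnN : n + 1 < (F.P K).sitesPerDir j)
    {δ : ℝ} {S₀ : Set (Plaq (F.P K) j)} (hS₀ : boxPlaqs lo hi ⊆ S₀) (hV : PlaqSmallOn S₀ δ (Averaging.iter (avOfRecord F N K) j (gaugeAct u₀ U₁))) (hδ : 0 ≤ δ)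
    {a : ℝ} (ha0 : 0 ≤ a)
    (ha : ∀ c : PBond (F.P K) j, c.src ∈ (castSite '' Set.Icc lo hi : Set (Site (F.P K) j)) → c.tgt ∈ (castSite '' Set.Icc lo hi : Set (Site (F.P K) j)) →
      dist1 (Averaging.iter (avOfRecord F N K) j U₁ c) ≤ a)
    (hσ : ((∑ κ, (hi κ - lo κ).toNat : ℕ) : ℝ) * ((((F.P K).d - 1 : ℕ) : ℝ) * n * δ + a) ≤ 1 / 80) (hv40 : (((F.P K).d - 1 : ℕ) : ℝ) * n * δ ≤ 1 / 40)
    {c : PBond (F.P K) j} (hs : c.src ∈ (castSite '' Set.Icc lo hi : Set (Site (F.P K) j))) (ht : c.tgt ∈ (castSite '' Set.Icc lo hi : Set (Site (F.P K) j))) :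
    ‖mlog ((Averaging.iter (avOfRecord F N K) j U₁ c : SU N) : MatA N) -
        (mlog ((((toMS (fun x => blockLift j (axialGauge (Averaging.iter (avOfRecord F N K) j (gaugeAct u₀ U₁)) lo hi) x * u₀ x) j (castSite lo))⁻¹ *
              Averaging.iter (avOfRecord F N K) j
                (gaugeAct (fun x => blockLift j (axialGauge (Averaging.iter (avOfRecord F N K) j (gaugeAct u₀ U₁)) lo hi) x * u₀ x) U₁) c *
              toMS (fun x => blockLift j (axialGauge (Averaging.iter (avOfRecord F N K) j (gaugeAct u₀ U₁)) lo hi) x * u₀ x) j (castSite lo) : SU N)) : MatA N) +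
          (mlog (((((toMS (fun x => blockLift j (axialGauge (Averaging.iter (avOfRecord F N K) j (gaugeAct u₀ U₁)) lo hi) x * u₀ x) j (castSite lo))⁻¹ *
                toMS (fun x => blockLift j (axialGauge (Averaging.iter (avOfRecord F N K) j (gaugeAct u₀ U₁)) lo hi) x * u₀ x) j c.src)⁻¹ : SU N)) : MatA N) -
            mlog (((((toMS (fun x => blockLift j (axialGauge (Averaging.iter (avOfRecord F N K) j (gaugeAct u₀ U₁)) lo hi) x * u₀ x) j (castSite lo))⁻¹ *
                toMS (fun x => blockLift j (axialGauge (Averaging.iter (avOfRecord F N K) j (gaugeAct u₀ U₁)) lo hi) x * u₀ x) j c.tgt)⁻¹ : SU N)) : MatA N)))‖ ≤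
      8 * (((∑ κ, (hi κ - lo κ).toNat : ℕ) : ℝ) * ((((F.P K).d - 1 : ℕ) : ℝ) * n * δ + a)) ^ 2 +
        20 * (((∑ κ, (hi κ - lo κ).toNat : ℕ) : ℝ) * ((((F.P K).d - 1 : ℕ) : ℝ) * n * δ + a)) * ((((F.P K).d - 1 : ℕ) : ℝ) * n * δ) :=
  norm_mlog_iter_avOfRecord_centred_sub_le_dataAxial F N K _ U₁ hj hn hnN (Averaging.iter (avOfRecord F N K) j (gaugeAct u₀ U₁)) hS₀ hV hδ
    (iter_avOfRecord_towerGauge_eq_dataAxial F N K hj u₀ U₁ lo hi) ha0 ha hσ hv40 hs ht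

/-- ★ **The same keyed on a MINIMISER OF RECORD**: if `U₁^{u₀}` minimises the Wilson action of record over data `V` in `bgReg` (NODE 00's (0.21) contract `IsBackground (avOfRecord F N K) (bgReg …) j V`),
then `M^j(U₁^{u₀}) = V` literally and the smallness is asked of `V` itself; by §2 `U₁^{u}` is the minimiser over `V^h`. [cite: Balaban1985Variational, (144)–(147) pp.300–301, (151)–(156) pp.301–302, (160) p.303] -/
theorem norm_mlog_iter_avOfRecord_centred_sub_le_towerGauge_of_isBackground (K : ℕ) (u₀ : GaugeTransf (F.P K) 0 (SU N)) (U₁ : GaugeField (F.P K) 0 (SU N)) {j : ℕ}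
    (hj : j ≤ (F.P K).m + (F.P K).K) {ε : ℝ} {V : GaugeField (F.P K) j (SU N)} (hbg : IsBackground (avOfRecord F N K) (bgReg F N K j ε) j V (gaugeAct u₀ U₁))
    {lo hi : Fin (F.P K).d → ℤ} {n : ℕ} (hn : ∀ κ, hi κ ≤ lo κ + n) (hnN : n + 1 < (F.P K).sitesPerDir j)
    {δ : ℝ} {S₀ : Set (Plaq (F.P K) j)} (hS₀ : boxPlaqs lo hi ⊆ S₀) (hV : PlaqSmallOn S₀ δ V) (hδ : 0 ≤ δ)
    {a : ℝ} (ha0 : 0 ≤ a)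
    (ha : ∀ c : PBond (F.P K) j, c.src ∈ (castSite '' Set.Icc lo hi : Set (Site (F.P K) j)) → c.tgt ∈ (castSite '' Set.Icc lo hi : Set (Site (F.P K) j)) →
      dist1 (Averaging.iter (avOfRecord F N K) j U₁ c) ≤ a)
    (hσ : ((∑ κ, (hi κ - lo κ).toNat : ℕ) : ℝ) * ((((F.P K).d - 1 : ℕ) : ℝ) * n * δ + a) ≤ 1 / 80) (hv40 : (((F.P K).d - 1 : ℕ) : ℝ) * n * δ ≤ 1 / 40)
    {c : PBond (F.P K) j} (hs : c.src ∈ (castSite '' Set.Icc lo hi : Set (Site (F.P K) j))) (ht : c.tgt ∈ (castSite '' Set.Icc lo hi : Set (Site (F.P K) j))) :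
    ‖mlog ((Averaging.iter (avOfRecord F N K) j U₁ c : SU N) : MatA N) -
        (mlog ((((toMS (fun x => blockLift j (axialGauge V lo hi) x * u₀ x) j (castSite lo))⁻¹ *
              Averaging.iter (avOfRecord F N K) j (gaugeAct (fun x => blockLift j (axialGauge V lo hi) x * u₀ x) U₁) c *
              toMS (fun x => blockLift j (axialGauge V lo hi) x * u₀ x) j (castSite lo) : SU N)) : MatA N) +
          (mlog (((((toMS (fun x => blockLift j (axialGauge V lo hi) x * u₀ x) j (castSite lo))⁻¹ *
                toMS (fun x => blockLift j (axialGauge V lo hi) x * u₀ x) j c.src)⁻¹ : SU N)) : MatA N) -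
            mlog (((((toMS (fun x => blockLift j (axialGauge V lo hi) x * u₀ x) j (castSite lo))⁻¹ *
                toMS (fun x => blockLift j (axialGauge V lo hi) x * u₀ x) j c.tgt)⁻¹ : SU N)) : MatA N)))‖ ≤
      8 * (((∑ κ, (hi κ - lo κ).toNat : ℕ) : ℝ) * ((((F.P K).d - 1 : ℕ) : ℝ) * n * δ + a)) ^ 2 +
        20 * (((∑ κ, (hi κ - lo κ).toNat : ℕ) : ℝ) * ((((F.P K).d - 1 : ℕ) : ℝ) * n * δ + a)) * ((((F.P K).d - 1 : ℕ) : ℝ) * n * δ) := by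
  have hdat : Averaging.iter (avOfRecord F N K) j (gaugeAct u₀ U₁) = V := hbg.1
  have h := norm_mlog_iter_avOfRecord_centred_sub_le_towerGauge F N K u₀ U₁ hj hn hnN hS₀ (hdat ▸ hV) hδ ha0 ha hσ hv40 hs ht
  rw [hdat] at h
  exact h

/-- ★★★ **ROWS (r1)+(r4) AT THE RECORD IN THE KNIT'S SHAPE — `hdata` DISCHARGED BY `hrep`**: for ANY `U′` (the axial-tower representative of the minimiser of record), `V := M^j(U′)` with `δ`-small
plaquettes based in the box ([B11] (7) for the data), and ANY pair `(u, U₁)` with `U₁^{u} = U′^{h̄}`, `h := axialGauge V lo hi` (`hrep`; [6] Thm 2's Landau copy in the knit), the composed row of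
p615982 holds with `v := (d−1)nδ` — displayed: the smallness of `V`, the Landau copy's letter `a`, extent∕non-wrapping, thresholds.
[cite: Balaban1985Variational, (147) p.301, (151)–(156) pp.301–302, (160) p.303] -/
theorem norm_mlog_iter_avOfRecord_centred_sub_le_of_rep (K : ℕ) (U' : GaugeField (F.P K) 0 (SU N)) (u : GaugeTransf (F.P K) 0 (SU N)) (U₁ : GaugeField (F.P K) 0 (SU N)) {j : ℕ}
    (hj : j ≤ (F.P K).m + (F.P K).K) {lo hi : Fin (F.P K).d → ℤ} {n : ℕ} (hn : ∀ κ, hi κ ≤ lo κ + n) (hnN : n + 1 < (F.P K).sitesPerDir j)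
    (hrep : gaugeAct u U₁ = gaugeAct (blockLift j (axialGauge (Averaging.iter (avOfRecord F N K) j U') lo hi)) U')
    {δ : ℝ} {S₀ : Set (Plaq (F.P K) j)} (hS₀ : boxPlaqs lo hi ⊆ S₀) (hV : PlaqSmallOn S₀ δ (Averaging.iter (avOfRecord F N K) j U')) (hδ : 0 ≤ δ)
    {a : ℝ} (ha0 : 0 ≤ a)
    (ha : ∀ c : PBond (F.P K) j, c.src ∈ (castSite '' Set.Icc lo hi : Set (Site (F.P K) j)) → c.tgt ∈ (castSite '' Set.Icc lo hi : Set (Site (F.P K) j)) →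
      dist1 (Averaging.iter (avOfRecord F N K) j U₁ c) ≤ a)
    (hσ : ((∑ κ, (hi κ - lo κ).toNat : ℕ) : ℝ) * ((((F.P K).d - 1 : ℕ) : ℝ) * n * δ + a) ≤ 1 / 80) (hv40 : (((F.P K).d - 1 : ℕ) : ℝ) * n * δ ≤ 1 / 40)
    {c : PBond (F.P K) j} (hs : c.src ∈ (castSite '' Set.Icc lo hi : Set (Site (F.P K) j))) (ht : c.tgt ∈ (castSite '' Set.Icc lo hi : Set (Site (F.P K) j))) :
    ‖mlog ((Averaging.iter (avOfRecord F N K) j U₁ c : SU N) : MatA N) -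
        (mlog ((((toMS u j (castSite lo))⁻¹ * Averaging.iter (avOfRecord F N K) j (gaugeAct u U₁) c * toMS u j (castSite lo) : SU N)) : MatA N) +
          (mlog (((((toMS u j (castSite lo))⁻¹ * toMS u j c.src)⁻¹ : SU N)) : MatA N) -
            mlog (((((toMS u j (castSite lo))⁻¹ * toMS u j c.tgt)⁻¹ : SU N)) : MatA N)))‖ ≤
      8 * (((∑ κ, (hi κ - lo κ).toNat : ℕ) : ℝ) * ((((F.P K).d - 1 : ℕ) : ℝ) * n * δ + a)) ^ 2 +
        20 * (((∑ κ, (hi κ - lo κ).toNat : ℕ) : ℝ) * ((((F.P K).d - 1 : ℕ) : ℝ) * n * δ + a)) * ((((F.P K).d - 1 : ℕ) : ℝ) * n * δ) :=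
  norm_mlog_iter_avOfRecord_centred_sub_le_dataAxial F N K u U₁ hj hn hnN (Averaging.iter (avOfRecord F N K) j U') hS₀ hV hδ
    (iter_avOfRecord_eq_dataAxial_of_rep F N K hj U' u U₁ lo hi hrep) ha0 ha hσ hv40 hs ht

end Rows

/-! ## §4  (A6) Non-vacuity at the flat datum -/

section NonVacuity

variable (F : T4Continuum.T4Family) (N : ℕ) [NeZero N]

/-- At `U₁ = 1`, `u₀ = 1` the representative's level-`j` data is the unit configuration (`B15Claim189UnitTestAtRecord.iter_avOfRecord_one`, `gaugeAct_one'`), so §2's identity reads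
`M^j(1^{h̄}) = 1^h` with `h = axialGauge 1 lo hi` and §3's plaquette hypothesis holds for every `δ > 0` on every plaquette set (`plaqSmallOn_one`) — the binder block of §3 is
inhabited on every box of every torus (with `a = 0`, this base's `N07ShearSizeTopBox.dist1_iter_avOfRecord_one`, and any `δ > 0` within the thresholds). [cite: Balaban1985Variational, (147) p.301 (bookkeeping)] -/
theorem towerGauge_data_one (K j : ℕ) :
    Averaging.iter (avOfRecord F N K) j (gaugeAct (fun _ => (1 : SU N)) (1 : GaugeField (F.P K) 0 (SU N))) = 1 := by
  rw [B12RTGaugeInvariance254.gaugeAct_one', B15Claim189UnitTestAtRecord.iter_avOfRecord_one F N K j]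

/-- The plaquette hypothesis of §3 at the flat datum: the unit data has `δ`-small plaquettes on every set, every `δ > 0` (`PlaqSmallOn` is the strict (7)).
[cite: Balaban1985Variational, (7) p.279 (bookkeeping)] -/
theorem plaqSmallOn_towerGauge_data_one (K j : ℕ) (S₀ : Set (Plaq (F.P K) j)) {δ : ℝ} (hδ : 0 < δ) :
    PlaqSmallOn S₀ δ (Averaging.iter (avOfRecord F N K) j (gaugeAct (fun _ => (1 : SU N)) (1 : GaugeField (F.P K) 0 (SU N)))) := by
  rw [towerGauge_data_one]
  exact T4SmallFieldWindowSandwich.plaqSmallOn_one S₀ hδ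

end NonVacuity

end Summit.QuantumFields.YangMills.BalabanUVNodes.N07ShearSizeTopBoxTowerGauge
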